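import Mathlib
import Summits.PneNP.PneNP.Theorems.ChebyshevTracialDesignJuntaCount
import HarnessLib

/-!
# Cell pnp-psdrank, route `ChebyshevTracialDesign`: weighted level sums — block decomposition, peeling one edge,
# peeling one ALIGNED pair of edges against its dipole factor

Harmonic backbone of the `r = 1` rung of the crux `TracialDecayExp20` (stmt-PneNP-19878), eng g8, part 1 of 3
(parts 2–3: `…AlignedDipoleRecursion`, `…AlignedDipoleDominance`). Vocabulary of the junta files
(`…JuntaCount`: `IsPMOn S M`, `cutCount`, the level classes `{U ⊆ S : #cr(U,M) = c, #in(U,M) = i}` of Rothvoß's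
odd-cut slack matrix [cite: Rothvoss2017, §2 (PDF p. 6)], here with an arbitrary pattern condition `p (#cr) (#in)`).
* `sum_pattern_union_eq_sum` — weighted form of `…Junta.card_fiber`: a pattern sum over `U ⊆ S₁ ∪ S₂` splits along the
  trace `B = U ∩ S₁`, the counts adding up blockwise;
* `sum_pattern_cons` — peeling one edge `uv` (weighted `…Junta.card_filter_cons`): external / crossing (two endpoints) /
  internal;
* `sum_pattern_pair_peel` — THE COMBINATORIAL HEART: peeling a head pair `xx'` and a tail pair `yy'` against the dipole
  factor `(1[x∈U] − 1[y∈U])(1[x'∈U] − 1[y'∈U])`: of the sixteen traces only `{x,x'}`, `{y,y'}` (factor `+1`: one more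
  internal edge) and `{x,y'}`, `{x',y}` (factor `−1`: two more crossing edges) survive, giving `2·Σ'(#in'+1) − 2·Σ'(#cr'+2)`.
This is the mechanism behind the level-INDEPENDENCE of the matching-side functional of the bi-mode expansion
(prover g5/g6 `…LevelColumnSums` (★), `…LevelDifference`) read on the cut side: iterating the peel gives the two-term
recursion of part 2 and the dominance of the tight level of part 3. [cite: GodsilMeagher2015, §15.2 (perfect matching scheme)]
Stature: support/instrument. WHAT THIS IS NOT: no spectral statement yet, nothing on psd rank, no P-vs-NP content. No
definitions. Supports crux stmt-PneNP-19878.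
-/

set_option linter.dupNamespace false -- `Summit.PneNP.PneNP.…`: summit = sub-problem (D-0017)

namespace Summit.PneNP.PneNP.Theorems.ChebyshevTracialDesignAlignedDipolePeel

open Finset Literature.Barriers.PneNP Summit.PneNP.PneNP.Theorems.ChebyshevTracialDesignJunta

variable {V : Type*} [DecidableEq V]

/-! ### §1 Weighted block decomposition of a pattern sum -/

/-- **Weighted fibre decomposition.** For disjoint vertex blocks `S₁, S₂` carrying edge sets `M₁ ⊆ S₁.sym2`,
`M₂ ⊆ S₂.sym2`, a weighted sum over the subsets `U ⊆ S₁ ∪ S₂` whose numbers of crossing and internal edges of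
`M₁ ∪ M₂` satisfy a condition `p` splits along the trace `B = U ∩ S₁`: the fibre over `B` is the set of `B ∪ U₂`,
`U₂ ⊆ S₂`, and the counts add up blockwise (weighted form of `…Junta.card_fiber`). [folklore] -/
theorem sum_pattern_union_eq_sum {S₁ S₂ : Finset V} {M₁ M₂ : Finset (Sym2 V)} (hd : Disjoint S₁ S₂)
    (h₁ : M₁ ⊆ S₁.sym2) (h₂ : M₂ ⊆ S₂.sym2) (p : ℕ → ℕ → Prop) [DecidableRel p] (f : Finset V → ℝ) :
    ∑ U ∈ (S₁ ∪ S₂).powerset.filter (fun U =>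
        p ((M₁ ∪ M₂).filter fun e => cutCount U e = 1).card ((M₁ ∪ M₂).filter fun e => cutCount U e = 2).card),
        f U =
      ∑ B ∈ S₁.powerset, ∑ U₂ ∈ S₂.powerset.filter (fun U₂ =>
          p ((M₁.filter fun e => cutCount B e = 1).card + (M₂.filter fun e => cutCount U₂ e = 1).card)
            ((M₁.filter fun e => cutCount B e = 2).card + (M₂.filter fun e => cutCount U₂ e = 2).card)),
        f (B ∪ U₂) := by
  have hdM : Disjoint M₁ M₂ := disjoint_of_subset_sym2 hd h₁ h₂
  have hsplit : ∀ (U : Finset V) (k : ℕ),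
      ((M₁ ∪ M₂).filter fun e => cutCount U e = k).card =
        (M₁.filter fun e => cutCount (U ∩ S₁) e = k).card + (M₂.filter fun e => cutCount (U ∩ S₂) e = k).card := by
    intro U k
    rw [card_filter_cutCount_union hdM, ← card_filter_cutCount_inter h₁, card_filter_cutCount_inter h₂]
  rw [← sum_fiberwise_of_maps_to (s := (S₁ ∪ S₂).powerset.filter (fun U =>
        p ((M₁ ∪ M₂).filter fun e => cutCount U e = 1).card ((M₁ ∪ M₂).filter fun e => cutCount U e = 2).card))
      (t := S₁.powerset) (g := fun U => U ∩ S₁) (fun U _ => mem_powerset.2 inter_subset_right)]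
  refine sum_congr rfl fun B hB => ?_
  have hBS : B ⊆ S₁ := mem_powerset.1 hB
  refine sum_nbij' (fun U => U ∩ S₂) (fun U₂ => B ∪ U₂) ?_ ?_ ?_ ?_ ?_
  · intro U hU
    simp only [mem_filter, mem_powerset] at hU ⊢
    obtain ⟨⟨-, hp⟩, hUB⟩ := hU
    have h1 := hsplit U 1
    have h2 := hsplit U 2
    rw [hUB] at h1 h2
    rw [h1, h2] at hp
    exact ⟨inter_subset_right, hp⟩
  · intro U₂ hU₂
    simp only [mem_filter, mem_powerset] at hU₂ ⊢
    obtain ⟨hU₂S, hp⟩ := hU₂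
    have hUB : (B ∪ U₂) ∩ S₁ = B := by
      rw [union_inter_distrib_right, inter_eq_left.2 hBS]
      have : U₂ ∩ S₁ = ∅ := disjoint_iff_inter_eq_empty.1 (disjoint_of_subset_left hU₂S hd.symm)
      rw [this, union_empty]
    have hU2 : (B ∪ U₂) ∩ S₂ = U₂ := by
      rw [union_inter_distrib_right, inter_eq_left.2 hU₂S]
      have : B ∩ S₂ = ∅ := disjoint_iff_inter_eq_empty.1 (disjoint_of_subset_left hBS hd)
      rw [this, empty_union]
    have h1 := hsplit (B ∪ U₂) 1
    have h2 := hsplit (B ∪ U₂) 2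
    rw [hUB, hU2] at h1 h2
    refine ⟨⟨union_subset_union hBS hU₂S, ?_⟩, hUB⟩
    rw [h1, h2]
    exact hp
  · intro U hU
    simp only [mem_filter, mem_powerset] at hU
    obtain ⟨⟨hUS, -⟩, hUB⟩ := hU
    show B ∪ U ∩ S₂ = U
    rw [← hUB, ← inter_union_distrib_left, inter_eq_left.2 hUS]
  · intro U₂ hU₂
    simp only [mem_filter, mem_powerset] at hU₂
    show (B ∪ U₂) ∩ S₂ = U₂
    rw [union_inter_distrib_right, inter_eq_left.2 hU₂.1]
    have : B ∩ S₂ = ∅ := disjoint_iff_inter_eq_empty.1 (disjoint_of_subset_left hBS hd)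
    rw [this, empty_union]
  · intro U hU
    simp only [mem_filter, mem_powerset] at hU
    obtain ⟨⟨hUS, -⟩, hUB⟩ := hU
    show f U = f (B ∪ U ∩ S₂)
    rw [← hUB, ← inter_union_distrib_left, inter_eq_left.2 hUS]

/-! ### §2 Peeling one edge (weighted form of `…Junta.card_filter_cons`) -/

/-- **Peeling one edge, weighted**: a pattern sum over `{u,v} ⊔ S₂` with the edge `uv` added splits by the trace of
`U` on `{u,v}` — external (`∅`), crossing (`{v}` or `{u}`: one more crossing edge), internal (`{u,v}`: one more
internal edge). [folklore] -/
theorem sum_pattern_cons {S₂ : Finset V} {M₂ : Finset (Sym2 V)} {u v : V} (huv : u ≠ v)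
    (hu : u ∉ S₂) (hv : v ∉ S₂) (h₂ : M₂ ⊆ S₂.sym2) (p : ℕ → ℕ → Prop) [DecidableRel p] (f : Finset V → ℝ) :
    ∑ U ∈ (({u, v} : Finset V) ∪ S₂).powerset.filter (fun U =>
        p ((({s(u, v)} : Finset (Sym2 V)) ∪ M₂).filter fun e => cutCount U e = 1).card
          ((({s(u, v)} : Finset (Sym2 V)) ∪ M₂).filter fun e => cutCount U e = 2).card), f U =
      ∑ U ∈ S₂.powerset.filter (fun U =>
          p (M₂.filter fun e => cutCount U e = 1).card (M₂.filter fun e => cutCount U e = 2).card), f (∅ ∪ U) +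
      ∑ U ∈ S₂.powerset.filter (fun U =>
          p (1 + (M₂.filter fun e => cutCount U e = 1).card) (M₂.filter fun e => cutCount U e = 2).card),
        f ({v} ∪ U) +
      (∑ U ∈ S₂.powerset.filter (fun U =>
          p (1 + (M₂.filter fun e => cutCount U e = 1).card) (M₂.filter fun e => cutCount U e = 2).card),
        f ({u} ∪ U) +
      ∑ U ∈ S₂.powerset.filter (fun U =>
          p (M₂.filter fun e => cutCount U e = 1).card (1 + (M₂.filter fun e => cutCount U e = 2).card)),
        f ({u, v} ∪ U)) := by
  have hd : Disjoint ({u, v} : Finset V) S₂ := by simp [hu, hv]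
  have h₁ : ({s(u, v)} : Finset (Sym2 V)) ⊆ ({u, v} : Finset V).sym2 := by
    intro e he
    rw [mem_singleton] at he
    subst he
    simp
  obtain ⟨⟨h00, h01⟩, ⟨h10, h11⟩, ⟨h20, h21⟩, ⟨h30, h31⟩⟩ := traces_pair huv
  rw [sum_pattern_union_eq_sum hd h₁ h₂, sum_powerset_pair huv]
  simp only [h00, h01, h10, h11, h20, h21, h30, h31, zero_add]

/-! ### §3 Peeling one ALIGNED pair of edges against its dipole factor -/

section PairPeel

variable {x x' y y' : V}

/-- Membership bookkeeping: for `B` inside the four points and `U` avoiding them, `w ∈ B ∪ U ↔ w ∈ B` for each of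
the four points `w`. [folklore] -/
theorem mem_union_iff_of_avoid {Q U : Finset V} (B : Finset V) (hU : Disjoint Q U) {w : V} (hw : w ∈ Q) :
    w ∈ B ∪ U ↔ w ∈ B := by
  rw [mem_union, or_iff_left]
  exact fun h => disjoint_left.1 hU hw h

/-- The dipole factor of one aligned pair, `(1[x ∈ U] − 1[y ∈ U])·(1[x' ∈ U] − 1[y' ∈ U])`, only sees the trace of
`U` on the four points. [folklore] -/
theorem factor_union_eq {S₃ U : Finset V} (B : Finset V)
    (hU : U ⊆ S₃) (hx : x ∉ S₃) (hx' : x' ∉ S₃) (hy : y ∉ S₃) (hy' : y' ∉ S₃) :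
    ((if x ∈ B ∪ U then (1 : ℝ) else 0) - (if y ∈ B ∪ U then (1 : ℝ) else 0)) *
        ((if x' ∈ B ∪ U then (1 : ℝ) else 0) - (if y' ∈ B ∪ U then (1 : ℝ) else 0)) =
      ((if x ∈ B then (1 : ℝ) else 0) - (if y ∈ B then (1 : ℝ) else 0)) *
        ((if x' ∈ B then (1 : ℝ) else 0) - (if y' ∈ B then (1 : ℝ) else 0)) := by
  have hQU : Disjoint ({x, x', y, y'} : Finset V) U := by
    rw [disjoint_left]
    intro w hw hwU
    have hwS := hU hwU
    simp only [mem_insert, mem_singleton] at hw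
    rcases hw with rfl | rfl | rfl | rfl
    · exact hx hwS
    · exact hx' hwS
    · exact hy hwS
    · exact hy' hwS
  have e1 : x ∈ B ∪ U ↔ x ∈ B := mem_union_iff_of_avoid B hQU (by simp)
  have e2 : x' ∈ B ∪ U ↔ x' ∈ B := mem_union_iff_of_avoid B hQU (by simp)
  have e3 : y ∈ B ∪ U ↔ y ∈ B := mem_union_iff_of_avoid B hQU (by simp)
  have e4 : y' ∈ B ∪ U ↔ y' ∈ B := mem_union_iff_of_avoid B hQU (by simp)
  simp only [e1, e2, e3, e4]

/-- Pulling the (trace-determined) dipole factor and a four-point-blind weight `R` out of a fibre sum. [folklore] -/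
theorem sum_factor_mul_eq {S₃ B : Finset V} (hB : B ⊆ ({x, x', y, y'} : Finset V))
    (hx : x ∉ S₃) (hx' : x' ∉ S₃) (hy : y ∉ S₃) (hy' : y' ∉ S₃)
    (R : Finset V → ℝ) (hR : ∀ B U : Finset V, B ⊆ ({x, x', y, y'} : Finset V) → R (B ∪ U) = R U)
    (T : Finset (Finset V)) (hT : T ⊆ S₃.powerset) :
    ∑ U ∈ T, ((if x ∈ B ∪ U then (1 : ℝ) else 0) - (if y ∈ B ∪ U then (1 : ℝ) else 0)) *
        ((if x' ∈ B ∪ U then (1 : ℝ) else 0) - (if y' ∈ B ∪ U then (1 : ℝ) else 0)) * R (B ∪ U) =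
      ((if x ∈ B then (1 : ℝ) else 0) - (if y ∈ B then (1 : ℝ) else 0)) *
        ((if x' ∈ B then (1 : ℝ) else 0) - (if y' ∈ B then (1 : ℝ) else 0)) * ∑ U ∈ T, R U := by
  rw [mul_sum]
  refine sum_congr rfl fun U hU => ?_
  rw [factor_union_eq B (mem_powerset.1 (hT hU)) hx hx' hy hy', hR B U hB]

/-- **Peeling one aligned pair** (the heart of the recursion). Let `x, x', y, y'` be four distinct points outside
`S₃`, carrying the two edges `xx'` (the head pair) and `yy'` (the tail pair), and let `R` be a weight blind to the
four points. Then the pattern sum of the dipole factor `(1[x∈U] − 1[y∈U])(1[x'∈U] − 1[y'∈U])·R(U)` over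
`U ⊆ {x,x'} ∪ ({y,y'} ∪ S₃)` equals `2·(sum over U ⊆ S₃ with one more internal edge) − 2·(sum with two more
crossing edges)`: of the sixteen traces of `U` on the four points only `{x,x'}`, `{y,y'}` (factor `+1`, one pair
internal and the other external) and `{x,y'}`, `{x',y}` (factor `−1`, both pairs crossing) survive. [folklore] -/
theorem sum_pattern_pair_peel {S₃ : Finset V} {M₃ : Finset (Sym2 V)} (h₃ : M₃ ⊆ S₃.sym2)
    (hxx' : x ≠ x') (hxy : x ≠ y) (hxy' : x ≠ y') (hx'y : x' ≠ y) (hx'y' : x' ≠ y') (hyy' : y ≠ y')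
    (hx : x ∉ S₃) (hx' : x' ∉ S₃) (hy : y ∉ S₃) (hy' : y' ∉ S₃)
    (p : ℕ → ℕ → Prop) [DecidableRel p]
    (R : Finset V → ℝ) (hR : ∀ B U : Finset V, B ⊆ ({x, x', y, y'} : Finset V) → R (B ∪ U) = R U) :
    ∑ U ∈ (({x, x'} : Finset V) ∪ (({y, y'} : Finset V) ∪ S₃)).powerset.filter (fun U =>
        p ((({s(x, x')} : Finset (Sym2 V)) ∪ (({s(y, y')} : Finset (Sym2 V)) ∪ M₃)).filter
            fun e => cutCount U e = 1).card
          ((({s(x, x')} : Finset (Sym2 V)) ∪ (({s(y, y')} : Finset (Sym2 V)) ∪ M₃)).filter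
            fun e => cutCount U e = 2).card),
        ((if x ∈ U then (1 : ℝ) else 0) - (if y ∈ U then (1 : ℝ) else 0)) *
          ((if x' ∈ U then (1 : ℝ) else 0) - (if y' ∈ U then (1 : ℝ) else 0)) * R U =
      2 * ∑ U ∈ S₃.powerset.filter (fun U =>
          p (M₃.filter fun e => cutCount U e = 1).card (1 + (M₃.filter fun e => cutCount U e = 2).card)), R U -
      2 * ∑ U ∈ S₃.powerset.filter (fun U =>
          p (1 + (1 + (M₃.filter fun e => cutCount U e = 1).card)) (M₃.filter fun e => cutCount U e = 2).card),
          R U := by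
  have hyS : y ∉ S₃ := hy
  have hM₂ : ({s(y, y')} : Finset (Sym2 V)) ∪ M₃ ⊆ (({y, y'} : Finset V) ∪ S₃).sym2 := by
    refine union_subset ?_ (h₃.trans (sym2_mono subset_union_right))
    intro e he
    rw [mem_singleton] at he
    subst he
    simp
  have hxS₂ : x ∉ ({y, y'} : Finset V) ∪ S₃ := by simp [hxy, hxy', hx]
  have hx'S₂ : x' ∉ ({y, y'} : Finset V) ∪ S₃ := by simp [hx'y, hx'y', hx']
  rw [sum_pattern_cons hxx' hxS₂ hx'S₂ hM₂]
  rw [sum_pattern_cons hyy' hy hy' h₃ p, sum_pattern_cons hyy' hy hy' h₃ (fun a b => p (1 + a) b),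
    sum_pattern_cons hyy' hy hy' h₃ (fun a b => p (1 + a) b), sum_pattern_cons hyy' hy hy' h₃ (fun a b => p a (1 + b))]
  -- regroup `B_X ∪ (B_Y ∪ U)` as `(B_X ∪ B_Y) ∪ U` and pull the factor out of each of the sixteen fibre sums
  simp only [← union_assoc]
  have hT : ∀ q : Finset V → Prop, ∀ [DecidablePred q], S₃.powerset.filter q ⊆ S₃.powerset :=
    fun q _ => filter_subset _ _
  have key : ∀ (B : Finset V), B ⊆ ({x, x', y, y'} : Finset V) → ∀ (q : Finset V → Prop) [DecidablePred q],
      ∑ U ∈ S₃.powerset.filter q, ((if x ∈ B ∪ U then (1 : ℝ) else 0) - (if y ∈ B ∪ U then (1 : ℝ) else 0)) *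
          ((if x' ∈ B ∪ U then (1 : ℝ) else 0) - (if y' ∈ B ∪ U then (1 : ℝ) else 0)) * R (B ∪ U) =
        ((if x ∈ B then (1 : ℝ) else 0) - (if y ∈ B then (1 : ℝ) else 0)) *
          ((if x' ∈ B then (1 : ℝ) else 0) - (if y' ∈ B then (1 : ℝ) else 0)) * ∑ U ∈ S₃.powerset.filter q, R U :=
    fun B hB q _ => sum_factor_mul_eq hB hx hx' hy hy' R hR _ (hT q)
  have s1 : (∅ : Finset V) ∪ ∅ ⊆ ({x, x', y, y'} : Finset V) := by simp
  have s2 : (∅ : Finset V) ∪ {y'} ⊆ ({x, x', y, y'} : Finset V) := by simp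
  have s3 : (∅ : Finset V) ∪ {y} ⊆ ({x, x', y, y'} : Finset V) := by simp
  have s4 : (∅ : Finset V) ∪ {y, y'} ⊆ ({x, x', y, y'} : Finset V) := by
    simp [insert_subset_iff]
  have s5 : ({x'} : Finset V) ∪ ∅ ⊆ ({x, x', y, y'} : Finset V) := by simp
  have s6 : ({x'} : Finset V) ∪ {y'} ⊆ ({x, x', y, y'} : Finset V) := by simp [insert_subset_iff]
  have s7 : ({x'} : Finset V) ∪ {y} ⊆ ({x, x', y, y'} : Finset V) := by simp [insert_subset_iff]
  have s8 : ({x'} : Finset V) ∪ {y, y'} ⊆ ({x, x', y, y'} : Finset V) := by simp [insert_subset_iff]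
  have s9 : ({x} : Finset V) ∪ ∅ ⊆ ({x, x', y, y'} : Finset V) := by simp
  have s10 : ({x} : Finset V) ∪ {y'} ⊆ ({x, x', y, y'} : Finset V) := by simp [insert_subset_iff]
  have s11 : ({x} : Finset V) ∪ {y} ⊆ ({x, x', y, y'} : Finset V) := by simp [insert_subset_iff]
  have s12 : ({x} : Finset V) ∪ {y, y'} ⊆ ({x, x', y, y'} : Finset V) := by simp [insert_subset_iff]
  have s13 : ({x, x'} : Finset V) ∪ ∅ ⊆ ({x, x', y, y'} : Finset V) := by simp [insert_subset_iff]
  have s14 : ({x, x'} : Finset V) ∪ {y'} ⊆ ({x, x', y, y'} : Finset V) := by simp [insert_subset_iff]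
  have s15 : ({x, x'} : Finset V) ∪ {y} ⊆ ({x, x', y, y'} : Finset V) := by simp [insert_subset_iff]
  have s16 : ({x, x'} : Finset V) ∪ {y, y'} ⊆ ({x, x', y, y'} : Finset V) := by simp [insert_subset_iff]
  rw [key _ s1, key _ s2, key _ s3, key _ s4, key _ s5, key _ s6, key _ s7, key _ s8, key _ s9, key _ s10,
    key _ s11, key _ s12, key _ s13, key _ s14, key _ s15, key _ s16]
  -- evaluate the sixteen factors
  simp only [empty_union, union_empty, mem_union, mem_insert, mem_singleton, notMem_empty]
  simp [hxx', hxy, hxy', hx'y, hx'y', hyy', hxx'.symm, hxy.symm, hxy'.symm, hx'y.symm, hx'y'.symm, hyy'.symm,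
    zero_add]
  ring

end PairPeel

end Summit.PneNP.PneNP.Theorems.ChebyshevTracialDesignAlignedDipolePeel
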